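import Summits.RiemannHypothesis.RiemannHypothesis.Theorems.Splittings.LinearRayLehmerWindowSub
import HarnessLib

/-!
# LINE L3 support item `LinearRayRange21` (stmt-RiemannHypothesis-21574) — the certified range, item form

Cell rh-split, seat rh-split-typer-1 g6 (prover; closing wrapper only, no new mathematics).  The L3 support
item of route DBN (planner rh-idea-2) reads, verbatim,
`∀ a : ℝ, a ≠ 0 → |a| ≤ 21 → ¬ HasOnlyRealZeros (linearFactorH a)`: for every `0 < |a| ≤ 21` the
linear-ray member `G_a = linearFactorH a` has a non-real zero.  This is exactly the headline of lane
(xviii-D) «LEHMER WINDOW» (rh-splitx-eng-5 g4), `Splittings.LinearRayLehmerWindow.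
not_hasOnlyRealZeros_linearFactorH_of_abs_le_twentyOne`, with the real parameter bound explicitly instead of
implicitly; the proof below is the one-line re-binding named in the item's informal text.
Axioms: those of the cited tree theorem (std + the lane's declared `native_decide` certificates
`ldDip/ldLow/ldHigh/ldSub_check`, the engine's `hiWin1/hiWin2_check`, the one-point lane's
`linRayGap/linRayWindowA/linRayWindowB_check`).
HONEST LABEL: the ray is RH-STRENGTHENING (`riemannHypothesis_of_exists_linearRay`); refuting it on
`0 < |a| ≤ 21` is RH-free negative-side bookkeeping for the C15 census — not a splitting; nothing here bears on
the truth of RH.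
-/

set_option linter.dupNamespace false

noncomputable section

namespace Summit.RiemannHypothesis.RiemannHypothesis.Theorems.Splittings.LinearRayLehmerWindow

open Literature.NumberTheory.LFunctions
open Literature.Barriers.RiemannHypothesis (linearFactorH)

/-- **The certified range of the linear-factor ray, item form (L3 `LinearRayRange21`)**: for every real `a` with
`a ≠ 0` and `|a| ≤ 21`, `linearFactorH a` does NOT have only real zeros.  One-line re-binding of
`not_hasOnlyRealZeros_linearFactorH_of_abs_le_twentyOne` (lane (xviii-D), rh-splitx-eng-5 g4). [folklore] -/
theorem linearRayRange21 :
    ∀ a : ℝ, a ≠ 0 → |a| ≤ 21 → ¬ HasOnlyRealZeros (linearFactorH a) :=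
  fun _a ha h => not_hasOnlyRealZeros_linearFactorH_of_abs_le_twentyOne ha h

end Summit.RiemannHypothesis.RiemannHypothesis.Theorems.Splittings.LinearRayLehmerWindow

end
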